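import Summits.ValiantsHypothesis.ValiantsHypothesis.Theorems.MatrixDescartes.Negative.MatrixDescartesFalseOfTropicalMonster
import Summits.ValiantsHypothesis.ValiantsHypothesis.Theorems.LacunarySymmetroidMatrixDescartesStubDominantInjective
import Summits.ValiantsHypothesis.ValiantsHypothesis.Theorems.LacunarySymmetroidMatrixDescartesCensusDefs

/-!
# `MatrixDescartes` — census vocabulary, tropical side: FORMAT-LEVEL laws over the tree's design vocabulary

(Part 1 of 2 — the statements, the elementary facts and the THIN TROPICAL LAW; the implication square between the
candidate laws is the companion module `…CensusTropicalKLawBridges`, split off only for the 400-line rule; all names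
live in the single namespace `…LacunarySymmetroidMatrixDescartes.TropicalCensus`.)

HONEST FRAMING.  Definitions-and-bridges companion of the census frame for the crux
`Summit.ValiantsHypothesis.ValiantsHypothesis.Theses.LacunarySymmetroid.MatrixDescartes` (ledger item
`stmt-ValiantsHypothesis-18050`, route `LacunarySymmetroid`; object-search cell `pub-symmetroid`, Conjecture-B ideation
seat conjb-2, lens «tropical first rung + lifting», 2026-08-25), landed as a HELPER of that item (no closure claim).
It TYPES candidate format-level statements as `Prop`s over existing declarations and proves only IMPLICATIONS between
them plus one elementary calibration theorem (`tropRootLawAt_thin`).  Nothing here asserts `KPlusLogSqLaw`,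
`MatrixDescartes` or anything about `VP ≠ VNP`; the conjectural statements are `def … : Prop`, never hypothesised
globally.  The statements `TropKPlusLogSqLaw` (TB) and `TropicalLifting` (LIFT) are the intended cruxes of the cell's
Conjecture-B route («KPlusLogSqLaw», D-0059), whose deciding chain is `kPlusLogSqLaw_of_lifting_of_tropKPlusLogSqLaw`
(this file) followed by `Census.matrixDescartes_of_kPlusLogSqLaw` (bridge file).

Vocabulary (tree, `MatrixDescartesFalseOfTropicalMonster.lean`): a TROPICAL DESIGN of format `(m, K)` is
`d : Fin K → ℕ` (exponents), `v ε : Fin m → Fin m → Fin K → ℤ` (valuations, signs); a Leibniz term is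
`p = (σ, λ) : Equiv.Perm (Fin m) × (Fin m → Fin K)` with `tropWeight d v θ p = θ·Σᵢ d(λ i) − Σᵢ v (σ i) i (λ i)` and
`termSign ε p = sign σ · Πᵢ ε (σ i) i (λ i)`; `IsDominant d v ε θ p` = `p` is the unique optimum at slope `θ`.
A chain of `n + 1` dominant terms at strictly increasing integer slopes with alternating signs patchworks to a real
pencil of the same format with `≥ n` distinct positive zeros (`le_card_posRoots_patch`).

Contents.
* `TropRootLawAt m K B` — the tropical twin of the census row `RealRootLawAt m K B`: every design of format `(m,K)`
  has at most `B` sign-alternating dominant breakpoints ("tropical positive zeros").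
* `TropKPlusLogSqLaw` (TB, "tropical Conjecture B"), `TropExponentLaw e` / `TropExponentLawSome` (TE, "the N-exponent of
  K-class parametric assignment is bounded uniformly in K, with a `2^{O(K)}` constant"), `TropK4Law e` (the V2b rung at
  `K = 4`: exponent `e`; the question of record is `e = 2` vs `e = 3`), `TropicalLifting` (LIFT: a tropical row lifts
  to the real row at the cost of a factor `2^{O(K)}`).
* PROVED: `tropRootLawAt_mono`; `tropRootLawAt_thin` — THIN TROPICAL LAW: `TropRootLawAt m K (m! · (m·(K−1)+1) − 1)` for
  all `m, K` (for fixed `σ` the dominant class vectors form a chain in the product order, so at most `m(K−1)+1` of them;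
  at `m = 2`: `≤ 4K − 3` for general designs, cf. the cell's symmetric patchwork ceiling `3K − 4`); in the companion
  module `…CensusTropicalKLawBridges`: the bridges `tropKPlusLogSqLaw_of_tropExponentLaw` (TE ⇒ TB), `not_tropicalMonster_of_tropKPlusLogSqLaw` (TB ⇒ ¬TropicalMonster),
  `kPlusLogSqLaw_of_lifting_of_tropExponentLaw` (LIFT ∧ TE ⇒ B), `kPlusLogSqLaw_of_lifting_of_tropKPlusLogSqLaw`
  (LIFT ∧ TB ⇒ B), `tropKPlusLogSqLaw_of_kPlusLogSqLaw` (B ⇒ TB, via patchworking + the symmetric doubling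
  `card_roots_SD`), hence `kPlusLogSqLaw_iff_trop_of_lifting` (**given LIFT, B ⇔ TB**: Conjecture B splits into a
  purely combinatorial statement about parametric assignment designs and a Viro-type lifting statement whose only
  parameter is the format).  TB is a CONSEQUENCE of B refutable by pure combinatorics: a `TropicalMonster`-type design
  family refutes TB, hence B; nothing is lost by attacking the tropical side first.
* `TropExponentLaw e` is recorded DEAD for every `e` (the tree's staircase `SymmetroidDescartes.DPR.stub_stair`, read
  as a dominance design, gives `m`-exponent `≥ (K − 2)/2` at `K` classes — see its docstring; the translation of the
  `DPR` walk vocabulary to `IsDominant` is not written here); the conjunct split of record is LIFT ∧ TB.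
-/

-- `Summit.ValiantsHypothesis.ValiantsHypothesis.…` repeats a component by the D-0017 layout
-- (single-conjunct summit), which the `dupNamespace` linter flags; the name is mandated.
set_option linter.dupNamespace false
set_option autoImplicit false

namespace Summit.ValiantsHypothesis.ValiantsHypothesis.Theorems.LacunarySymmetroidMatrixDescartes.TropicalCensus

open Summit.ValiantsHypothesis.ValiantsHypothesis.Theorems.MatrixDescartes.Negative
open Summit.ValiantsHypothesis.ValiantsHypothesis.Theorems.LacunarySymmetroidMatrixDescartes
open scoped BigOperators
open Finset

/-! ## 1. The tropical row predicate and the candidate laws (all `Prop`s, never asserted) -/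

/-- **Tropical census row.** `TropRootLawAt m K B`: every tropical design of format `(m, K)` (signs in `{−1,0,1}`)
admits at most `B` sign-alternating dominant breakpoints, i.e. every chain of `n + 1` unique optima at strictly
increasing integer slopes with alternating term signs has `n ≤ B`.  Exactly the hypothesis list of the tree's
`TropicalMonster` / `le_card_posRoots_patch`, quantified per format. [definition of the cell] -/
def TropRootLawAt (m K B : ℕ) : Prop :=
  ∀ (d : Fin K → ℕ) (v ε : Fin m → Fin m → Fin K → ℤ) (n : ℕ) (θ : Fin (n + 1) → ℤ)
    (p : Fin (n + 1) → Equiv.Perm (Fin m) × (Fin m → Fin K)),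
    (∀ i j l, (ε i j l).natAbs ≤ 1) → StrictMono θ → (∀ k, IsDominant d v ε (θ k) (p k)) →
    (∀ k : Fin n, termSign ε (p k.castSucc) * termSign ε (p k.succ) < 0) → n ≤ B

/-- **TB — tropical Conjecture B** (candidate, NOT asserted): `log₂ T(m,K) ≤ C·(K + log₂² m)` for the tropical
capacity `T(m,K)`, in the census currency of `KPlusLogSqLaw`. [conjecture of the cell; no citation exists] -/
def TropKPlusLogSqLaw : Prop :=
  ∃ C : ℕ, ∀ m K : ℕ, TropRootLawAt m K (2 ^ (C * (K + Nat.log 2 m ^ 2)))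

/-- **TE(e) — tropical exponent law with exponent `e`** (candidate, NOT asserted; **REFUTED IN THE KERNEL:
`KPlusLogSqLaw.WalkDesign.not_tropExponentLaw : ∀ e, ¬ TropExponentLaw e` and `not_tropK4Law_one`
(`Theorems/KPlusLogSqLawTropicalBStaircaseDesign.lean`, p429737, R1374), paper record 2026-08-25**): the number
of sign-alternating breakpoints of a `K`-slope-class parametric assignment design on `m` nodes is at most
`2^{C K} · m^e`, i.e. the `m`-exponent is bounded UNIFORMLY in `K`.  WHY DEAD: the tree's
STAIRCASE family (`SymmetroidDescartes.DPR.stub_stair`, the engine of `not_DerivedPencilRolle`; Carstensen 1983 /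
Mulmuley–Shah 2001, mirror-free) is natively a dominance design — `L+1` edge classes plus the closing class, walk
matrix `I − Z₀ − W·u vᵀ` on `m₀ = (T_L+1)·2R ≤ 2^{2L+3}·n²` nodes (blueprint `Cruxes/DerivedPencilRolle/Lines/
staircase-refutation.md` §3; layers × heights), with `n^L − 1` sign-alternating uniquely dominant walks (walks ↔ Leibniz
terms) — so `T(m₀, L+2) ≥ n^L − 1`: the `m`-exponent at `K` classes is AT LEAST `(K − 2)/2`, unbounded in `K`, and
`TropExponentLaw e` fails at `K = 2e + 3`.  (Kernel translation: the WalkDesign modules p428536–p429737; the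
implication theorems below that take TE as a hypothesis are correct and vacuous.)  What survives is the fixed-`K`
rung `TropK4Law 2` below (at `K = 4` the staircase itself is weak — `n² − 1` on `≤ 128 n²` nodes —
and exponent `≥ 2` comes from `K = 3` designs) and, at Conjecture-B scale, `TropKPlusLogSqLaw` itself (the staircase
has `log₂ T ≈ L·log₂ n ≤ log₂² m₀`, inside TB with `C = 1`). [candidate of the cell, refuted in the kernel p429737;
no external citation exists] -/
def TropExponentLaw (e : ℕ) : Prop :=
  ∃ C : ℕ, ∀ m K : ℕ, TropRootLawAt m K (2 ^ (C * K) * m ^ e)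

/-- **TE — some uniform exponent** (candidate, NOT asserted). [candidate of the cell, refuted on paper; no citation exists] -/
def TropExponentLawSome : Prop := ∃ e : ℕ, TropExponentLaw e

/-- **The V2b rung at `K = 4` with exponent `e`** (candidate, NOT asserted): `T(m,4) ≤ C · (m+1)^e`.  The first open
case of record: does `TropK4Law 2` hold (the fourth slope class buys nothing in the exponent: `K = 3` designs already
give `C(m+2,2) − 1`), or do `K = 4` designs with `Θ(m³)` alternating breakpoints exist (`¬ TropK4Law 2`; a third
MULTIPLYING digit)?  `TropK4Law 3` holds by count vectors
(`C(m+3,3) − 1`, Descartes; not formalised here).  Calibration, not a test of B: at fixed `K` both answers sit far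
inside `2^{C (K + log² m)}`. [open question of the cell; no citation exists] -/
def TropK4Law (e : ℕ) : Prop :=
  ∃ C : ℕ, ∀ m : ℕ, TropRootLawAt m 4 (C * (m + 1) ^ e)

/-- **LIFT — format-level lifting** (candidate, NOT asserted): a tropical row lifts to the real (symmetric, all real
zeros) row of the SAME format at the cost of a factor `2^{C K}`: `TropRootLawAt m K n → RealRootLawAt m K (2^{CK}·(n+1))`.
Pencil-level lifting (`ζ(F) ≤ B_trop(F)`) is FALSE — the census row `(2,4) = 9` exceeds the symmetric patchwork ceiling
`3·4 − 4 = 8` (cell, PATCHWORK-CEILING.md), the determinantal analogue of the Li–Wang counterexample to the Itenberg–Roy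
multivariate Descartes rule (zbl:0905.14033); LIFT only asks for the format maxima to be comparable up to `2^{O(K)}`. [conjecture of the cell; no citation exists] -/
def TropicalLifting : Prop :=
  ∃ C : ℕ, ∀ m K n : ℕ, TropRootLawAt m K n → RealRootLawAt m K (2 ^ (C * K) * (n + 1))

/-! ## 2. Elementary facts: monotonicity, the `K = 0` corner, the THIN TROPICAL LAW -/

/-- Monotonicity of the tropical row in the bound. [folklore] -/
theorem tropRootLawAt_mono {m K B B' : ℕ} (hBB' : B ≤ B') (h : TropRootLawAt m K B) : TropRootLawAt m K B' :=
  fun d v ε n θ p hε hθ hdom halt => (h d v ε n θ p hε hθ hdom halt).trans hBB'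

/-- With no slope class (`K = 0`) there is no alternation at all. [folklore] -/
theorem tropRootLawAt_zero (m B : ℕ) : TropRootLawAt m 0 B := by
  intro d v ε n θ p hε hθ hdom halt
  rcases Nat.eq_zero_or_pos m with hm | hm
  · subst hm
    rcases Nat.eq_zero_or_pos n with hn | hn
    · omega
    · exfalso
      have h := halt ⟨0, hn⟩
      have hts : ∀ q : Equiv.Perm (Fin 0) × (Fin 0 → Fin 0), termSign ε q = 1 := by
        intro q
        have hq : q.1 = 1 := Subsingleton.elim _ _
        simp [termSign, hq]
      rw [hts, hts] at h
      norm_num at h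
  · exact ((p 0).2 ⟨0, hm⟩).elim0

section Thin

variable {m K : ℕ}

/-- number of classes with strictly smaller exponent [definition of the cell] -/
def dRank (d : Fin K → ℕ) (l : Fin K) : ℕ := (univ.filter fun l' => d l' < d l).card

/-- the exponent rank of a class is at most `K − 1` (the class itself is excluded) [folklore] -/
theorem dRank_le (d : Fin K → ℕ) (l : Fin K) : dRank d l ≤ K - 1 := by
  unfold dRank
  have hsub : (univ.filter fun l' => d l' < d l) ⊆ univ.erase l := by
    intro x hx
    rw [mem_filter] at hx
    rw [mem_erase]
    exact ⟨fun h => lt_irrefl _ (h ▸ hx.2), mem_univ _⟩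
  calc (univ.filter fun l' => d l' < d l).card ≤ (univ.erase l).card := card_le_card hsub
    _ = K - 1 := by rw [card_erase_of_mem (mem_univ l), card_univ, Fintype.card_fin]

/-- the exponent rank is strictly monotone in the exponent [folklore] -/
theorem dRank_lt_of_lt (d : Fin K → ℕ) {l l' : Fin K} (h : d l < d l') : dRank d l < dRank d l' := by
  unfold dRank
  apply card_lt_card
  rw [ssubset_iff_of_subset]
  · refine ⟨l, ?_, ?_⟩
    · rw [mem_filter]; exact ⟨mem_univ _, h⟩
    · rw [mem_filter]; exact fun hh => lt_irrefl _ hh.2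
  · intro x hx
    rw [mem_filter] at hx ⊢
    exact ⟨mem_univ _, hx.2.trans h⟩

/-- a sum over `Fin m` after updating one argument of the inner function [folklore] -/
theorem sum_update_arg (G : Fin m → Fin K → ℤ) (μ : Fin m → Fin K) (i : Fin m) (x : Fin K) :
    ∑ j, G j (Function.update μ i x j) = ∑ j, G j (μ j) - G i (μ i) + G i x := by
  have h1 := sum_erase_add univ (fun j => G j (Function.update μ i x j)) (mem_univ i)
  have h2 := sum_erase_add univ (fun j => G j (μ j)) (mem_univ i)
  have h3 : ∑ j ∈ univ.erase i, G j (Function.update μ i x j) = ∑ j ∈ univ.erase i, G j (μ j) := by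
    apply sum_congr rfl
    intro j hj
    rw [Function.update_of_ne (ne_of_mem_erase hj)]
  simp only [Function.update_self] at h1
  linarith

/-- a present term stays present after replacing the class at one entry by a class that is present in
another present term with the same permutation [folklore] -/
theorem termSign_update_ne_zero (ε : Fin m → Fin m → Fin K → ℤ) (σ : Equiv.Perm (Fin m))
    (μ ν : Fin m → Fin K) (hμ : termSign ε (σ, μ) ≠ 0) (hν : termSign ε (σ, ν) ≠ 0) (i : Fin m) :
    termSign ε (σ, Function.update μ i (ν i)) ≠ 0 := by
  unfold termSign at *
  dsimp only at *
  have hμ' := (mul_ne_zero_iff.mp hμ).2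
  have hν' := (mul_ne_zero_iff.mp hν).2
  refine mul_ne_zero (mul_ne_zero_iff.mp hμ).1 ?_
  rw [prod_ne_zero_iff] at hμ' hν' ⊢
  intro j _
  by_cases hji : j = i
  · subst hji
    rw [Function.update_self]
    exact hν' j (mem_univ _)
  · rw [Function.update_of_ne hji]
    exact hμ' j (mem_univ _)

/-- **Entrywise monotonicity of dominant classes.**  If `(σ, μ)` is the unique optimum at slope `θa` and `(σ, ν)` (same
permutation) at a larger slope `θb`, then at every entry where the classes differ the exponent strictly increases. [folklore] -/
theorem d_lt_of_dominant (d : Fin K → ℕ) (v ε : Fin m → Fin m → Fin K → ℤ) {θa θb : ℤ} (hab : θa < θb)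
    (σ : Equiv.Perm (Fin m)) (μ ν : Fin m → Fin K) (ha : IsDominant d v ε θa (σ, μ))
    (hb : IsDominant d v ε θb (σ, ν)) (i : Fin m) (hi : μ i ≠ ν i) : d (μ i) < d (ν i) := by
  -- the two swapped terms are present and different from the optima
  have hqa : termSign ε (σ, Function.update μ i (ν i)) ≠ 0 := termSign_update_ne_zero ε σ μ ν ha.1 hb.1 i
  have hqb : termSign ε (σ, Function.update ν i (μ i)) ≠ 0 := termSign_update_ne_zero ε σ ν μ hb.1 ha.1 i
  have hnea : (σ, Function.update μ i (ν i)) ≠ (σ, μ) := by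
    intro h
    have := congrArg (fun q : Equiv.Perm (Fin m) × (Fin m → Fin K) => q.2 i) h
    simp only [Function.update_self] at this
    exact hi this.symm
  have hneb : (σ, Function.update ν i (μ i)) ≠ (σ, ν) := by
    intro h
    have := congrArg (fun q : Equiv.Perm (Fin m) × (Fin m → Fin K) => q.2 i) h
    simp only [Function.update_self] at this
    exact hi this
  have h1 := ha.2 _ hnea hqa
  have h2 := hb.2 _ hneb hqb
  unfold tropWeight at h1 h2
  simp only at h1 h2
  rw [sum_update_arg (fun _ l => (d l : ℤ)) μ i (ν i), sum_update_arg (fun j l => v (σ j) j l) μ i (ν i)] at h1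
  rw [sum_update_arg (fun _ l => (d l : ℤ)) ν i (μ i), sum_update_arg (fun j l => v (σ j) j l) ν i (μ i)] at h2
  -- add the two strict inequalities: (θb − θa) · (d ν i − d μ i) > 0
  have h3 : (θb - θa) * ((d (ν i) : ℤ) - d (μ i)) > 0 := by nlinarith
  have h4 : (0 : ℤ) < (d (ν i) : ℤ) - d (μ i) := by
    by_contra hcon
    push Not at hcon
    have : (θb - θa) * ((d (ν i) : ℤ) - d (μ i)) ≤ 0 :=
      mul_nonpos_of_nonneg_of_nonpos (by linarith) hcon
    linarith
  exact_mod_cast (sub_pos.mp h4)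

/-- total exponent rank of the class vector of a term [definition of the cell] -/
def termRank (d : Fin K → ℕ) (p : Equiv.Perm (Fin m) × (Fin m → Fin K)) : ℕ := ∑ i, dRank d (p.2 i)

/-- the total exponent rank of a term lies in `[0, m(K−1)]` [folklore] -/
theorem termRank_le (d : Fin K → ℕ) (p : Equiv.Perm (Fin m) × (Fin m → Fin K)) :
    termRank d p ≤ m * (K - 1) := by
  unfold termRank
  calc ∑ i, dRank d (p.2 i) ≤ ∑ _i : Fin m, (K - 1) := sum_le_sum fun i _ => dRank_le d _
    _ = m * (K - 1) := by rw [sum_const, card_univ, Fintype.card_fin, smul_eq_mul]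

/-- **THIN TROPICAL LAW** (theorem): every tropical design of format `(m, K)` has at most `m!·(m(K−1)+1) − 1`
sign-alternating dominant breakpoints.  Proof: dominant terms at increasing slopes are pairwise distinct
(`stub_dominantInjective`), and for a fixed permutation `σ` their class vectors strictly increase in the product
order of exponents (`d_lt_of_dominant`), hence have strictly increasing total rank `∈ [0, m(K−1)]`; so
`k ↦ (σₖ, termRank)` is injective into a set of size `m!·(m(K−1)+1)`.  Consequence: at every FIXED size `m` the
tropical column is LINEAR in `K` (`4K − 3` at `m = 2`), while the Descartes ceiling `C(m+K−1,m) − 1` is a degree-`m`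
polynomial in `K`; whatever exceeds `m!·m·K` in a real thin column is cancellation, invisible to patchworking. [folklore] -/
theorem tropRootLawAt_thin (m K : ℕ) : TropRootLawAt m K (m.factorial * (m * (K - 1) + 1) - 1) := by
  intro d v ε n θ p hε hθ hdom halt
  have hinj : Function.Injective p := stub_dominantInjective m K d v ε n θ p hθ hdom halt
  -- the comparison map
  let f : Fin (n + 1) → Equiv.Perm (Fin m) × Fin (m * (K - 1) + 1) :=
    fun k => ((p k).1, ⟨termRank d (p k), Nat.lt_succ_of_le (termRank_le d (p k))⟩)
  -- key: same permutation and a < b forces termRank (p a) < termRank (p b)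
  have hkey : ∀ a b : Fin (n + 1), a < b → (p a).1 = (p b).1 → termRank d (p a) < termRank d (p b) := by
    intro a b hab h1
    have hne : p a ≠ p b := fun h => (ne_of_lt hab) (hinj h)
    have h2 : (p a).2 ≠ (p b).2 := by
      intro h; exact hne (Prod.ext h1 h)
    obtain ⟨i, hi⟩ := Function.ne_iff.mp h2
    have hpa : p a = ((p a).1, (p a).2) := rfl
    have hpb : p b = ((p a).1, (p b).2) := by rw [h1]
    have hda : IsDominant d v ε (θ a) ((p a).1, (p a).2) := hpa ▸ hdom a
    have hdb : IsDominant d v ε (θ b) ((p a).1, (p b).2) := hpb ▸ hdom b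
    have hmono : ∀ j, dRank d ((p a).2 j) ≤ dRank d ((p b).2 j) := by
      intro j
      by_cases hj : (p a).2 j = (p b).2 j
      · rw [hj]
      · exact (dRank_lt_of_lt d (d_lt_of_dominant d v ε (hθ hab) _ _ _ hda hdb j hj)).le
    have hstrict : dRank d ((p a).2 i) < dRank d ((p b).2 i) :=
      dRank_lt_of_lt d (d_lt_of_dominant d v ε (hθ hab) _ _ _ hda hdb i hi)
    unfold termRank
    exact sum_lt_sum (fun j _ => hmono j) ⟨i, mem_univ _, hstrict⟩
  have hf : Function.Injective f := by
    intro a b hfab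
    have h1 : (p a).1 = (p b).1 := by
      have := congrArg Prod.fst hfab
      simpa [f] using this
    have h2 : termRank d (p a) = termRank d (p b) := by
      have := congrArg (fun q => (q.2 : ℕ)) hfab
      simpa [f] using this
    rcases lt_trichotomy a b with h | h | h
    · exact absurd h2 (ne_of_lt (hkey a b h h1))
    · exact h
    · exact absurd h2.symm (ne_of_lt (hkey b a h h1.symm))
  have hcard := Fintype.card_le_of_injective f hf
  simp only [Fintype.card_fin, Fintype.card_prod, Fintype.card_perm] at hcard
  omega

/-- The thin law at `m = 2`: at most `4K − 3` alternating breakpoints for GENERAL `2 × 2` designs (the cell's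
`3K − 4` is the SYMMETRIC hyperbolic-frame ceiling). [folklore] -/
theorem tropRootLawAt_two (K : ℕ) (hK : 1 ≤ K) : TropRootLawAt 2 K (4 * K - 3) := by
  have h := tropRootLawAt_thin 2 K
  have e : Nat.factorial 2 * (2 * (K - 1) + 1) - 1 = 4 * K - 3 := by
    rw [Nat.factorial_two]; omega
  rwa [e] at h

end Thin

end Summit.ValiantsHypothesis.ValiantsHypothesis.Theorems.LacunarySymmetroidMatrixDescartes.TropicalCensus
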